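import Literature.IUT.HodgeTheaters.PiAvatarKitCoreObstruction
import HarnessLib

/-!
# [IUTchI] Prop 6.7 / Ex 4.4 at the NAMED genuine Π-avatar kits of record: no `EvalBinder`, no `KitCore` when a bad-pair avatar is closed
# (node IUTchI:Prop6.7, law (γ); corollaries of `PiAvatarKitCoreObstruction` — proof-only, no definition, no new `Prop` fact)

S. Mochizuki, *Inter-universal Teichmüller theory I*, kurims manuscript (May 2020), Example 4.4 (i)(ii) pp. 106–107, Proposition 6.7 p. 167,
Definition 3.1 (e)(f) pp. 62–63 («`Π_v̲ := Π^tp_{X̳_v̲}`» at `v̲ ∈ 𝕍^bad`) ([IUTchI] Prop 6.7 p.167) [claim: Mochizuki2012, status: disputed]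
(D-0012 claim key, series status DISPUTED — kernel theorems about abc-iut's own kit constructions; nothing of the series is asserted,
no side is taken on [IUTchIII] Cor. 3.12).

The kits of record built from the real `InitialThetaData` — abc-iut-L5-t4 `baseKitOfTorsionMonodromy` (p446463, the CERT-L5 §6 kit),
`baseKitOfBadPairs` / `baseKitStandIn` (p448457), `baseKitNFOfBadPairs` / `baseKitNFStandIn` (p450281, J-NF-1; the latter is the kit of
abc-iut-L5-t3's `kitCoreStandIn E` / `thetaAgrees_standIn`, p452433) — are `baseKitOfData` / `baseKitNFOfData` at the local data
`localDatumAt`, whose local group at a bad index is the bad pair's `Π_{X̳_v̲}` (`(B v h).H`) resp., at the `X̲→`-stand-in, `Π_{X̲→_K} ∩ augGF⁻¹ G_v̲`.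
Read off from `PiAvatarKitCoreObstruction`: an `EvalBinder` (Ex 4.4 (i)(ii) evaluation sections) or a `KitCore` with any §4 datum over any
of these kits forces that group to be conjugate STRICTLY into itself inside the profinite `Π_{C_F}`; hence NONE exists as soon as the group
at ONE bad index is CLOSED (closed subgroups of profinite groups are never strictly self-conjugate).  typed ≠ inhabited ≠ discharged; an
obstruction about OUR kit design (D1 EMBEDDED orbit-category ambient), not a claim about print.
-/

namespace Literature.IUT.HodgeTheaters

open CategoryTheory

universe u v w

section NamedKits

variable {F : Type u} {K : Type v} {Fbar : Type w} [Field F] [NumberField F] [Field K] [NumberField K]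
  [Algebra F K] [Field Fbar] [Algebra F Fbar] [Algebra K Fbar]
  {E : WeierstrassCurve F} [E.IsElliptic] {l : ℕ} {Pb : BadPlacePredicates K}
  (D : InitialThetaData F K Fbar E l Pb) (CG : D.geom.pe.CuspGalois) (hS : D.CuspClassesNormaliserStable) [Fact l.Prime]

namespace InitialThetaData

variable (M : D.TorsionMonodromy) (hA : D.geom.pe.ArrowCoveringClaims)
  (hI : ∀ k ∈ D.geom.pe.inertia D.geom.pe.ε1, M.tau (D.geom.embK k) = 0)
  (B : ∀ v, v ∈ D.indexCopyBad → D.BadPairAt v) (ΛBad : ∀ v (h : v ∈ D.indexCopyBad), D.LocalArrowLaw CG hS (B v h).H)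
  (hsign : ∀ v : D.IndexCopy, v ∉ D.indexCopyBad → ∀ n : D.PiC,
    n ∈ Subgroup.normalizer ((D.PiXarrow ⊓ (D.decompAt v).comap D.augGF : Subgroup D.PiC) : Set D.PiC) →
      ∀ hn : n ∈ Subgroup.normalizer ((D.PiXund : Subgroup D.PiC) : Set D.PiC),
        ∃ ε : ℤˣ, ∀ x, D.gChart₀Model CG (D.actF CG hS ⟨n, hn⟩ x) = ε • D.gChart₀Model CG x)

/-- **`baseKitOfTorsionMonodromy` (the CERT-L5 kit, p446463): an `EvalBinder` forces the bad pair's `Π_{X̳_v̲}` to be conjugate STRICTLY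
into itself.** ([IUTchI] Ex 4.4 (i) p.106) [claim: Mochizuki2012, status: disputed] -/
theorem exists_conj_lt_of_evalBinder_baseKitOfTorsionMonodromy
    (Eb : (D.baseKitOfTorsionMonodromy CG hS M hA hI B hsign ΛBad).EvalBinder) {v : D.IndexCopy} (hv : v ∈ D.indexCopyBad) :
    ∃ a : D.PiC, (∀ x ∈ (B v hv).H, a⁻¹ * x * a ∈ (B v hv).H) ∧
      a ∉ Subgroup.normalizer (((B v hv).H : Subgroup D.PiC) : Set D.PiC) := by
  haveI := M.normal_PiXund_subgroupOf_PiXK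
  have h := D.exists_conj_lt_of_evalBinder_baseKitOfData CG hS (D.toFlStarGlobal_surjective_of_torsionMonodromy M) _ _ _ Eb hv
  rwa [D.localDatumAt_H, D.localGroupAt_of_mem B hv] at h

/-- **`baseKitOfTorsionMonodromy`: NO `EvalBinder` if one bad pair's `Π_{X̳_v̲}` is closed in `Π_{C_F}`.**
([IUTchI] Ex 4.4 (i) p.106) [claim: Mochizuki2012, status: disputed] -/
theorem isEmpty_evalBinder_baseKitOfTorsionMonodromy_of_isClosed {v : D.IndexCopy} (hv : v ∈ D.indexCopyBad)
    (hcl : IsClosed (((B v hv).H : Subgroup D.PiC) : Set D.PiC)) :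
    IsEmpty (D.baseKitOfTorsionMonodromy CG hS M hA hI B hsign ΛBad).EvalBinder := by
  haveI := M.normal_PiXund_subgroupOf_PiXK
  refine D.isEmpty_evalBinder_baseKitOfData_of_isClosed CG hS (D.toFlStarGlobal_surjective_of_torsionMonodromy M) _ _ _ hv ?_
  rwa [D.localDatumAt_H, D.localGroupAt_of_mem B hv]

/-- **`baseKitOfBadPairs` (p448457): NO `EvalBinder` if one bad pair's `Π_{X̳_v̲}` is closed.**
([IUTchI] Ex 4.4 (i) p.106) [claim: Mochizuki2012, status: disputed] -/
theorem isEmpty_evalBinder_baseKitOfBadPairs_of_isClosed {v : D.IndexCopy} (hv : v ∈ D.indexCopyBad)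
    (hcl : IsClosed (((B v hv).H : Subgroup D.PiC) : Set D.PiC)) :
    IsEmpty (D.baseKitOfBadPairs CG hS M hA hI B ΛBad).EvalBinder :=
  D.isEmpty_evalBinder_baseKitOfTorsionMonodromy_of_isClosed CG hS M hA hI B ΛBad _ hv hcl

/-- **`baseKitNFOfBadPairs` (p450281): an `EvalBinder` forces a strictly self-conjugate `Π_{X̳_v̲}`.**
([IUTchI] Ex 4.4 (i) p.106) [claim: Mochizuki2012, status: disputed] -/
theorem exists_conj_lt_of_evalBinder_baseKitNFOfBadPairs
    (Eb : (D.baseKitNFOfBadPairs CG hS M hA hI B ΛBad).EvalBinder) {v : D.IndexCopy} (hv : v ∈ D.indexCopyBad) :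
    ∃ a : D.PiC, (∀ x ∈ (B v hv).H, a⁻¹ * x * a ∈ (B v hv).H) ∧
      a ∉ Subgroup.normalizer (((B v hv).H : Subgroup D.PiC) : Set D.PiC) := by
  haveI := M.normal_PiXund_subgroupOf_PiXK
  have h := D.exists_conj_lt_of_evalBinder_baseKitNFOfData CG hS (D.toFlStarGlobal_surjective_of_torsionMonodromy M) _ _ _ Eb hv
  rwa [D.localDatumAt_H, D.localGroupAt_of_mem B hv] at h

/-- **`baseKitNFOfBadPairs`: NO `EvalBinder` if one bad pair's `Π_{X̳_v̲}` is closed.** ([IUTchI] Ex 4.4 (i) p.106) [claim: Mochizuki2012, status: disputed] -/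
theorem isEmpty_evalBinder_baseKitNFOfBadPairs_of_isClosed {v : D.IndexCopy} (hv : v ∈ D.indexCopyBad)
    (hcl : IsClosed (((B v hv).H : Subgroup D.PiC) : Set D.PiC)) :
    IsEmpty (D.baseKitNFOfBadPairs CG hS M hA hI B ΛBad).EvalBinder := by
  haveI := M.normal_PiXund_subgroupOf_PiXK
  refine D.isEmpty_evalBinder_baseKitNFOfData_of_isClosed CG hS (D.toFlStarGlobal_surjective_of_torsionMonodromy M) _ _ _ hv ?_
  rwa [D.localDatumAt_H, D.localGroupAt_of_mem B hv]

/-- **`baseKitStandIn` (p448457): an `EvalBinder` forces `Π_{X̲→_K} ∩ augGF⁻¹ G_v̲` (at a bad index) to be conjugate STRICTLY into itself.**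
([IUTchI] Ex 4.4 (i) p.106) [claim: Mochizuki2012, status: disputed] -/
theorem exists_conj_lt_of_evalBinder_baseKitStandIn
    (Eb : (D.baseKitStandIn CG hS M hA hI).EvalBinder) {v : D.IndexCopy} (hv : v ∈ D.indexCopyBad) :
    ∃ a : D.PiC, (∀ x ∈ D.PiXarrow ⊓ (D.decompAt v).comap D.augGF, a⁻¹ * x * a ∈ D.PiXarrow ⊓ (D.decompAt v).comap D.augGF) ∧
      a ∉ Subgroup.normalizer ((D.PiXarrow ⊓ (D.decompAt v).comap D.augGF : Subgroup D.PiC) : Set D.PiC) := by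
  haveI := M.normal_PiXund_subgroupOf_PiXK
  have h := D.exists_conj_lt_of_evalBinder_baseKitOfData CG hS (D.toFlStarGlobal_surjective_of_torsionMonodromy M) _ _ _ Eb hv
  rwa [D.localDatumAt_H, D.localGroupAt_badPairAtArrow] at h

/-- **`baseKitStandIn`: NO `EvalBinder` if `Π_{X̲→_K} ∩ augGF⁻¹ G_v̲` is closed at one bad index.**
([IUTchI] Ex 4.4 (i) p.106) [claim: Mochizuki2012, status: disputed] -/
theorem isEmpty_evalBinder_baseKitStandIn_of_isClosed {v : D.IndexCopy} (hv : v ∈ D.indexCopyBad)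
    (hcl : IsClosed ((D.PiXarrow ⊓ (D.decompAt v).comap D.augGF : Subgroup D.PiC) : Set D.PiC)) :
    IsEmpty (D.baseKitStandIn CG hS M hA hI).EvalBinder := by
  haveI := M.normal_PiXund_subgroupOf_PiXK
  refine D.isEmpty_evalBinder_baseKitOfData_of_isClosed CG hS (D.toFlStarGlobal_surjective_of_torsionMonodromy M) _ _ _ hv ?_
  rwa [D.localDatumAt_H, D.localGroupAt_badPairAtArrow]

/-- **`baseKitNFStandIn` (p450281; the kit of abc-iut-L5-t3's `kitCoreStandIn E`, p452433): an `EvalBinder` forces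
`Π_{X̲→_K} ∩ augGF⁻¹ G_v̲` at a bad index to be conjugate STRICTLY into itself.** ([IUTchI] Ex 4.4 (i) p.106) [claim: Mochizuki2012, status: disputed] -/
theorem exists_conj_lt_of_evalBinder_baseKitNFStandIn
    (Eb : (D.baseKitNFStandIn CG hS M hA hI).EvalBinder) {v : D.IndexCopy} (hv : v ∈ D.indexCopyBad) :
    ∃ a : D.PiC, (∀ x ∈ D.PiXarrow ⊓ (D.decompAt v).comap D.augGF, a⁻¹ * x * a ∈ D.PiXarrow ⊓ (D.decompAt v).comap D.augGF) ∧
      a ∉ Subgroup.normalizer ((D.PiXarrow ⊓ (D.decompAt v).comap D.augGF : Subgroup D.PiC) : Set D.PiC) := by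
  haveI := M.normal_PiXund_subgroupOf_PiXK
  have h := D.exists_conj_lt_of_evalBinder_baseKitNFOfData CG hS (D.toFlStarGlobal_surjective_of_torsionMonodromy M) _ _ _ Eb hv
  rwa [D.localDatumAt_H, D.localGroupAt_badPairAtArrow] at h

/-- **`baseKitNFStandIn`: NO `EvalBinder` — so abc-iut-L5-t3's binder `E` of `kitCoreStandIn E` / `thetaAgrees_standIn` is uninhabited —
if `Π_{X̲→_K} ∩ augGF⁻¹ G_v̲` is closed at one bad index.** ([IUTchI] Ex 4.4 (i) p.106) [claim: Mochizuki2012, status: disputed] -/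
theorem isEmpty_evalBinder_baseKitNFStandIn_of_isClosed {v : D.IndexCopy} (hv : v ∈ D.indexCopyBad)
    (hcl : IsClosed ((D.PiXarrow ⊓ (D.decompAt v).comap D.augGF : Subgroup D.PiC) : Set D.PiC)) :
    IsEmpty (D.baseKitNFStandIn CG hS M hA hI).EvalBinder := by
  haveI := M.normal_PiXund_subgroupOf_PiXK
  refine D.isEmpty_evalBinder_baseKitNFOfData_of_isClosed CG hS (D.toFlStarGlobal_surjective_of_torsionMonodromy M) _ _ _ hv ?_
  rwa [D.localDatumAt_H, D.localGroupAt_badPairAtArrow]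

end InitialThetaData

/-! ### Core agreements with an ARBITRARY §4 datum `𝔡` at the named kits (the kit's prime read as `𝔡.l`) -/

section KitCoreNamed

variable (𝔡 : BaseThetaDatum.{w}) (D' : InitialThetaData F K Fbar E 𝔡.l Pb) (CG' : D'.geom.pe.CuspGalois)
  (hS' : D'.CuspClassesNormaliserStable) (M' : D'.TorsionMonodromy) (hA' : D'.geom.pe.ArrowCoveringClaims)
  (hI' : ∀ k ∈ D'.geom.pe.inertia D'.geom.pe.ε1, M'.tau (D'.geom.embK k) = 0)
  (B' : ∀ v, v ∈ D'.indexCopyBad → D'.BadPairAt v) (ΛBad' : ∀ v (h : v ∈ D'.indexCopyBad), D'.LocalArrowLaw CG' hS' (B' v h).H)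
  (hsign' : ∀ v : D'.IndexCopy, v ∉ D'.indexCopyBad → ∀ n : D'.PiC,
    n ∈ Subgroup.normalizer ((D'.PiXarrow ⊓ (D'.decompAt v).comap D'.augGF : Subgroup D'.PiC) : Set D'.PiC) →
      ∀ hn : n ∈ Subgroup.normalizer ((D'.PiXund : Subgroup D'.PiC) : Set D'.PiC),
        ∃ ε : ℤˣ, ∀ x, D'.gChart₀Model CG' (D'.actF CG' hS' ⟨n, hn⟩ x) = ε • D'.gChart₀Model CG' x)

/-- **`baseKitOfTorsionMonodromy` (CERT-L5 kit): NO `KitCore` with ANY §4 datum if one bad pair's `Π_{X̳_v̲}` is closed** — law (γ)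
`KitCore.ThetaAgrees` has no instance there. ([IUTchI] Prop 6.7 p.167) [claim: Mochizuki2012, status: disputed] -/
theorem InitialThetaData.isEmpty_kitCore_baseKitOfTorsionMonodromy_of_isClosed {v : D'.IndexCopy} (hv : v ∈ D'.indexCopyBad)
    (hcl : IsClosed (((B' v hv).H : Subgroup D'.PiC) : Set D'.PiC)) :
    IsEmpty (𝔡.KitCore (D'.baseKitOfTorsionMonodromy CG' hS' M' hA' hI' B' hsign' ΛBad')) := by
  haveI := M'.normal_PiXund_subgroupOf_PiXK
  refine D'.isEmpty_kitCore_baseKitOfData_of_isClosed 𝔡 CG' hS' (D'.toFlStarGlobal_surjective_of_torsionMonodromy M') _ _ _ hv ?_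
  rwa [D'.localDatumAt_H, D'.localGroupAt_of_mem B' hv]

/-- **`baseKitOfBadPairs`: NO `KitCore` with ANY §4 datum if one bad pair's `Π_{X̳_v̲}` is closed.** ([IUTchI] Prop 6.7 p.167) [claim: Mochizuki2012, status: disputed] -/
theorem InitialThetaData.isEmpty_kitCore_baseKitOfBadPairs_of_isClosed {v : D'.IndexCopy} (hv : v ∈ D'.indexCopyBad)
    (hcl : IsClosed (((B' v hv).H : Subgroup D'.PiC) : Set D'.PiC)) :
    IsEmpty (𝔡.KitCore (D'.baseKitOfBadPairs CG' hS' M' hA' hI' B' ΛBad')) :=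
  D'.isEmpty_kitCore_baseKitOfTorsionMonodromy_of_isClosed 𝔡 CG' hS' M' hA' hI' B' ΛBad' _ hv hcl

/-- **`baseKitNFOfBadPairs` (J-NF-1 genuine shape): NO `KitCore` with ANY §4 datum if one bad pair's `Π_{X̳_v̲}` is closed.**
([IUTchI] Prop 6.7 p.167) [claim: Mochizuki2012, status: disputed] -/
theorem InitialThetaData.isEmpty_kitCore_baseKitNFOfBadPairs_of_isClosed {v : D'.IndexCopy} (hv : v ∈ D'.indexCopyBad)
    (hcl : IsClosed (((B' v hv).H : Subgroup D'.PiC) : Set D'.PiC)) :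
    IsEmpty (𝔡.KitCore (D'.baseKitNFOfBadPairs CG' hS' M' hA' hI' B' ΛBad')) := by
  haveI := M'.normal_PiXund_subgroupOf_PiXK
  refine D'.isEmpty_kitCore_baseKitNFOfData_of_isClosed 𝔡 CG' hS' (D'.toFlStarGlobal_surjective_of_torsionMonodromy M') _ _ _ hv ?_
  rwa [D'.localDatumAt_H, D'.localGroupAt_of_mem B' hv]

/-- **`baseKitStandIn`: NO `KitCore` with ANY §4 datum if `Π_{X̲→_K} ∩ augGF⁻¹ G_v̲` is closed at one bad index.**
([IUTchI] Prop 6.7 p.167) [claim: Mochizuki2012, status: disputed] -/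
theorem InitialThetaData.isEmpty_kitCore_baseKitStandIn_of_isClosed {v : D'.IndexCopy} (hv : v ∈ D'.indexCopyBad)
    (hcl : IsClosed ((D'.PiXarrow ⊓ (D'.decompAt v).comap D'.augGF : Subgroup D'.PiC) : Set D'.PiC)) :
    IsEmpty (𝔡.KitCore (D'.baseKitStandIn CG' hS' M' hA' hI')) := by
  haveI := M'.normal_PiXund_subgroupOf_PiXK
  refine D'.isEmpty_kitCore_baseKitOfData_of_isClosed 𝔡 CG' hS' (D'.toFlStarGlobal_surjective_of_torsionMonodromy M') _ _ _ hv ?_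
  rwa [D'.localDatumAt_H, D'.localGroupAt_badPairAtArrow]

/-- **`baseKitNFStandIn` — the kit of abc-iut-L5-t3's `kitCoreStandIn E : (baseThetaDatumStandIn E).KitCore (baseKitNFStandIn …)`
(p452433): NO `KitCore` with ANY §4 datum if `Π_{X̲→_K} ∩ augGF⁻¹ G_v̲` is closed at one bad index** (consistently with the
previous file: its binder `E : EvalBinder` is then uninhabited). ([IUTchI] Prop 6.7 p.167) [claim: Mochizuki2012, status: disputed] -/
theorem InitialThetaData.isEmpty_kitCore_baseKitNFStandIn_of_isClosed {v : D'.IndexCopy} (hv : v ∈ D'.indexCopyBad)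
    (hcl : IsClosed ((D'.PiXarrow ⊓ (D'.decompAt v).comap D'.augGF : Subgroup D'.PiC) : Set D'.PiC)) :
    IsEmpty (𝔡.KitCore (D'.baseKitNFStandIn CG' hS' M' hA' hI')) := by
  haveI := M'.normal_PiXund_subgroupOf_PiXK
  refine D'.isEmpty_kitCore_baseKitNFOfData_of_isClosed 𝔡 CG' hS' (D'.toFlStarGlobal_surjective_of_torsionMonodromy M') _ _ _ hv ?_
  rwa [D'.localDatumAt_H, D'.localGroupAt_badPairAtArrow]

end KitCoreNamed

end NamedKits

end Literature.IUT.HodgeTheaters
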